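import Summits.ABC.StewartYu.ArchG3Schedule
import Summits.ABC.StewartYu.ArchG3PackClosed
import Summits.ABC.StewartYu.ArchG3HalfSupply
import HarnessLib

/-!
# Cell abc-stewartyu, rung A1.L (crux r2 `ArchCoreRat`), WP-L.A: the archimedean Kummer HALF-STEP record package FROM ONE INEQUALITY —
# closed forms for the termwise integrality `Dh`, the termwise size `Mt` and the half-point weight bound `Wh`

`Summits/ABC/StewartYu/ArchG3PackClosedHalf.lean` — sequel to lp-1's `ArchG3Schedule` (`ArchHalfStepHypU`, `halfStep_of_hypU`), to
`ArchG3PackClosed` (`GammaC`, `YC`, `DΔC`, `ArchSupply.WC`, `den₀ = ν(H)^a`) and to `ArchG3HalfSupply` (the termwise supply) (cell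
`abc-stewartyu`, HOME `run/shared/lean/pub/abc-stewartyu/`; TRANCHE PLAN v1.2 §4′ P-A6/P-A8 interface; seat p5 g8; plan RULINGS R30(b)/(d),
R32 ANNEX 2 + CORRECTION).  Definitions (`DhC`, `MtC`) and theorems on `ArchG3Setup`; no named fact, no record.  Archimedean twin of p2's
`PadicG3PackClosedHalf.halfStepHypU_of_ineq`: for the level polynomials `R = Δ(·; i.1, H) ∘ 2^{ex+1}·`, `R′ = Δ(·; i.1, H) ∘ 2^{ex}·` (half-point
relation `(Hasse_a R)(s/2) = 2ᵃ (Hasse_a R′)(s)`, `ArchSupply.hasse_scaledFeldR_half`) on unknowns `U` with `i.1 ≤ L₀`, every datum of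
`ArchHalfStepHypU` is a CLOSED FORM of `(H, ex, L₀)`, the box `L`, the Δ-basis `(c, e)` and the radii:

* `DhC L H a s = ν(H)^a · monDen(α, ⌊(L|s|+1)/2⌋)` — clears `(Hasse_a Rᵢ)(s/2) · qEhZ w s` on the box (`ArchG3HalfSupply.exists_int_clear_mul_hasse_mul_qEhZ_of_box`
  + `ArchSupply.exists_int_lcm_pow_mul_hasse_scaledFeldR_half`); CURRENCY (Θ) of R32 ANNEX 2: EXACT generator-denominators `monDen S.α`, no weight
  floors — at `S(θ)` the record pairs it with the weight-decreasing saturated basis (factor `F ≤ 2ⁿ`);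
* `MtC …  = WC H (ex+1) L₀ T′ N₁ · exp(Σⱼ ⌊(Lⱼ(2N₁−1)+1)/2⌋·Aⱼ)` — bounds the same term uniformly over `a < T′`, odd `|s| ≤ 2N₁−1`, `i ∈ U` and the
  box (`abs_hasse_mul_qEhZ_le_of_box` + `|s|/2 ≤ N₁`); print's per-point monomial size `2^{−s}·n·L·|x|/2` ((4.44), Lemma 3.11 over `K`);
* `Wh = WC H (ex+1) L₀ T′ N₁` (`ArchSupply.norm_hw_le_WC` on `‖s/2‖ ≤ N₁`), `Wn = WC H (ex+1) L₀ T N`, `Wd = WC H (ex+1) L₀ T′ ((3E+1)(2N+1)+N)`;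
* **`archHalfStepHypU_of_ineq`** — `ArchHalfStepHypU R R′ U L P w γb c e c′ δ₀ N N₁ T T′` from the schedule data (`1 ≤ t`, `T′ + t ≤ T`,
  `2N₁ ≤ 6N+5`), `c′ ≠ 0`, `|log αₖ| ≤ Aₖ`, `E ≥ 1`, `C ≥ 1`, `w ≥ 0`, `L_{j₀}δ₀(3N+2) ≤ 1`, `H ≥ 1`, and ONE inequality per odd `s` and `(a, μ)` —
  lp-1's `hfinal` with the closed forms substituted (right-hand side `(1 + #U·P·DΔC·MtC)/(4·DhC·(1 + #U·P·DΔC·MtC)·(∏H(αⱼ))²)^{2ⁿ}`, whose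
  logarithm `ArchG3HalfSupply.liouville_threshold_eq_exp` / `log_liouville_base_le` / `log_den₀_mul_monDen_le` / `ArchSupply.log_lcm_pow_le` express).

WHAT THIS IS NOT: the inequality (record `ArchG3Par*`, seat p1); the k-step packages (`ArchG3PackClosed`); no crux moves.

## References
* Yu. V. Nesterenko, *Linear forms in logarithms of rational numbers*, LNM 1819 (2003) — §4.3 (4.36)–(4.37) p. 90, (4.42)–(4.45) p. 91–92,
  Lemma 3.11 over `K` p. 93; §3.5 Lemma 3.10 (3.35). [Nesterenko2003]
* K. Yu, Compositio Math. 74 (1990) — Lemma 2.5 (the `p`-adic model; cell file `PadicG3PackClosedHalf`). [Yu1990]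
-/

noncomputable section

open Finset Polynomial
open Literature.NumberTheory.Transcendental
open Literature.NumberTheory.Transcendental.CW77 (heightProd)
open Literature.NumberTheory.Transcendental.CW77.Setup (Tau tauNorm)
open Summit.ABC.StewartYu.ArchSupply (scaledFeldR WC)
open scoped Nat

namespace Summit.ABC.StewartYu

namespace ArchG3Setup

variable (S : ArchG3Setup) {K : Type*}

/-! ### The half box, uniformly in `|s| ≤ 2N₁ − 1` -/

/-- The half box is monotone in `|s|`: `⌊(Lⱼ|s|+1)/2⌋ ≤ ⌊(Lⱼ·Sb+1)/2⌋` for `|s| ≤ Sb`. [folklore] -/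
theorem halfBox_le_of_abs_le (L : Fin S.n → ℕ) {s : ℤ} {Sb : ℕ} (hs : |s| ≤ (Sb : ℤ)) (j : Fin S.n) :
    (L j * s.natAbs + 1) / 2 ≤ (L j * Sb + 1) / 2 := by
  have h1 : (s.natAbs : ℤ) ≤ Sb := by rw [Int.natCast_natAbs]; exact hs
  have h2 : s.natAbs ≤ Sb := by exact_mod_cast h1
  exact Nat.div_le_div_right (Nat.add_le_add_right (Nat.mul_le_mul_left (L j) h2) 1)

/-- An odd-node bound `|s| ≤ 2N₁ − 1` (integers) is the natural bound `|s| ≤ (2N₁ − 1 : ℕ)`. [folklore] -/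
theorem abs_le_natSub_of_abs_le {s : ℤ} {N₁ : ℕ} (hs : |s| ≤ 2 * (N₁ : ℤ) - 1) : |s| ≤ ((2 * N₁ - 1 : ℕ) : ℤ) := by
  have h0 : 0 ≤ |s| := abs_nonneg s
  omega

/-- `‖s/2‖ ≤ N₁` for `|s| ≤ 2N₁ − 1`. [folklore] -/
theorem norm_half_le_of_abs_le {s : ℤ} {N₁ : ℕ} (hs : |s| ≤ 2 * (N₁ : ℤ) - 1) : ‖((s : ℂ) / 2)‖ ≤ (N₁ : ℝ) := by
  have hs' : |(s : ℝ)| ≤ 2 * (N₁ : ℝ) - 1 := by exact_mod_cast hs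
  rw [norm_div, Complex.norm_intCast]
  norm_num
  linarith

/-- **The termwise size, uniformly on `|s| ≤ Sb`** (box `|wⱼ| ≤ Lⱼ`): `|(Hasse_a f)(s/2) · qEhZ w s| ≤ Xh · exp(Σⱼ ⌊(Lⱼ·Sb+1)/2⌋·Aⱼ)`.
[cite: Nesterenko2003, §4.3 (4.44), p. 92] -/
theorem abs_hasse_mul_qEhZ_le_of_abs_le {A : Fin S.n → ℝ} (hA : ∀ j, |S.lg j| ≤ A j) {L : Fin S.n → ℕ} {w' : Fin S.n → ℤ}
    (hw : ∀ j, |w' j| ≤ (L j : ℤ)) {s : ℤ} {Sb : ℕ} (hs : |s| ≤ (Sb : ℤ)) (f : ℚ[X]) (a : ℕ) {Xh : ℝ}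
    (hX : |(((hasseDeriv a f).eval ((s : ℚ) / 2) : ℚ) : ℝ)| ≤ Xh) :
    |((((hasseDeriv a f).eval ((s : ℚ) / 2) * S.qEhZ w' s : ℚ)) : ℝ)| ≤
      Xh * Real.exp (∑ j, ((((L j * Sb + 1) / 2 : ℕ)) : ℝ) * A j) := by
  refine (S.abs_hasse_mul_qEhZ_le_of_box hA hw s f a hX).trans ?_
  have hXh0 : 0 ≤ Xh := (abs_nonneg _).trans hX
  refine mul_le_mul_of_nonneg_left (Real.exp_le_exp.mpr (sum_le_sum fun j _ => ?_)) hXh0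
  have hA0 : 0 ≤ A j := (abs_nonneg _).trans (hA j)
  exact mul_le_mul_of_nonneg_right (by exact_mod_cast S.halfBox_le_of_abs_le L hs j) hA0

/-! ### The closed forms `Dh`, `Mt` -/

/-- **The termwise clearing denominator** `DhC L H a s = ν(H)^a · monDen(α, ⌊(L|s|+1)/2⌋)` (exact generator-denominators; currency (Θ)).
[cite: Nesterenko2003, §4.3 (4.42)–(4.43), p. 91; shape only] -/
def DhC (L : Fin S.n → ℕ) (H a : ℕ) (s : ℤ) : ℕ :=
  (Nat.lcmUpto H) ^ a * MonomialDen.monDen S.α (fun j => (L j * s.natAbs + 1) / 2)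

/-- `1 ≤ DhC`. [folklore] -/
theorem one_le_DhC (L : Fin S.n → ℕ) (H a : ℕ) (s : ℤ) : 1 ≤ S.DhC L H a s :=
  one_le_mul (Nat.one_le_pow _ _ (Nat.lcmUpto_pos H)) (MonomialDen.one_le_monDen S.α S.α_ne _)

/-- **`DhC` clears the half-point terms of the level polynomials one level up**: for `|wⱼ| ≤ Lⱼ`,
`DhC L H a s · ((Hasse_a (Δ(·;ℓ,H)∘2^{ex+1}·))(s/2) · qEhZ w s) ∈ ℤ`. [cite: Nesterenko2003, §4.3 (4.42)–(4.43), p. 91] -/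
theorem exists_int_DhC_mul (L : Fin S.n → ℕ) {H : ℕ} (hH : 1 ≤ H) (ℓ ex a : ℕ) (s : ℤ) {w' : Fin S.n → ℤ}
    (hw : ∀ j, |w' j| ≤ (L j : ℤ)) :
    ∃ z : ℤ, (S.DhC L H a s : ℚ) * ((hasseDeriv a (scaledFeldR ℓ H (ex + 1))).eval ((s : ℚ) / 2) * S.qEhZ w' s) = z :=
  S.exists_int_clear_mul_hasse_mul_qEhZ_of_box hw s _ a (ArchSupply.exists_int_lcm_pow_mul_hasse_scaledFeldR_half ℓ hH ex a s)

/-- **The termwise size** `MtC A L H ex L₀ T′ N₁ = WC H (ex+1) L₀ T′ N₁ · exp(Σⱼ ⌊(Lⱼ(2N₁−1)+1)/2⌋·Aⱼ)`.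
[cite: Nesterenko2003, §4.3 (4.44), p. 92; shape only] -/
def MtC (A : Fin S.n → ℝ) (L : Fin S.n → ℕ) (H ex L₀ T' N₁ : ℕ) : ℝ :=
  WC H (ex + 1) L₀ T' N₁ * Real.exp (∑ j, ((((L j * (2 * N₁ - 1) + 1) / 2 : ℕ)) : ℝ) * A j)

/-- `0 ≤ MtC`. [folklore] -/
theorem MtC_nonneg (A : Fin S.n → ℝ) (L : Fin S.n → ℕ) (H ex L₀ T' N₁ : ℕ) : 0 ≤ S.MtC A L H ex L₀ T' N₁ :=
  mul_nonneg (ArchSupply.WC_nonneg H (ex + 1) L₀ T' (Nat.cast_nonneg N₁)) (Real.exp_pos _).le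

/-- **`MtC` bounds the half-point terms** for `i.1 ≤ L₀`, `a < T′`, `|s| ≤ 2N₁ − 1`, `|wⱼ| ≤ Lⱼ`, `|log αⱼ| ≤ Aⱼ`.
[cite: Nesterenko2003, §4.3 (4.44) and Lemma 3.11 over K, p. 92–93] -/
theorem abs_hasse_mul_qEhZ_le_MtC {A : Fin S.n → ℝ} (hA : ∀ j, |S.lg j| ≤ A j) (L : Fin S.n → ℕ) {H : ℕ} (hH : 1 ≤ H)
    (ex : ℕ) {L₀ T' N₁ : ℕ} (i : ℕ × K) (hi : i.1 ≤ L₀) {a : ℕ} (ha : a < T') {s : ℤ} (hs : |s| ≤ 2 * (N₁ : ℤ) - 1)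
    {w' : Fin S.n → ℤ} (hw : ∀ j, |w' j| ≤ (L j : ℤ)) :
    |((((hasseDeriv a (scaledFeldR i.1 H (ex + 1))).eval ((s : ℚ) / 2) * S.qEhZ w' s : ℚ)) : ℝ)| ≤ S.MtC A L H ex L₀ T' N₁ := by
  have hX : |(((hasseDeriv a (scaledFeldR i.1 H (ex + 1))).eval ((s : ℚ) / 2) : ℚ) : ℝ)| ≤ WC H (ex + 1) L₀ T' N₁ := by
    have h := ArchSupply.norm_hw_le_WC (K := K) hH (ex + 1) i hi ha.le (norm_half_le_of_abs_le hs)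
    rw [show ((s : ℂ) / 2) = ((((s : ℚ) / 2 : ℚ)) : ℂ) by push_cast; ring, ArchG3Setup.hw_eval_ratCast,
      ← Complex.ofReal_ratCast, Complex.norm_real, Real.norm_eq_abs] at h
    exact h
  exact S.abs_hasse_mul_qEhZ_le_of_abs_le hA hw (abs_le_natSub_of_abs_le hs) _ a hX

/-! ### The half-step package from one inequality -/

/-- **`ArchHalfStepHypU` from one inequality.**  For `R = Δ(·; i.1, H) ∘ 2^{ex+1}·`, `R′ = Δ(·; i.1, H) ∘ 2^{ex}·` on unknowns `U` with
`i.1 ≤ L₀`, the half-step package holds with `ca a := 2ᵃ`, `Γ := GammaC L`, `DΔ := DΔC (YC c e L) T′`, `Wd/Wn/Wh := WC …`,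
`Dh := DhC L H`, `Mt := MtC A L H ex L₀ T′ N₁`, given the schedule data and ONE inequality per odd `s`, `|s| ≤ 2N₁−1`, and `(a, μ)`,
`a + |μ| < T′`. [cite: Nesterenko2003, §4.3 (4.36)–(4.51), p. 90–95; shape only] [cite: Yu1990, Lemma 2.5; shape only] -/
theorem archHalfStepHypU_of_ineq {H : ℕ} (hH : 1 ≤ H) (ex L₀ : ℕ) (U : Finset (ℕ × K)) (hU : ∀ i ∈ U, i.1 ≤ L₀)
    (L : Fin S.n → ℕ) (P : ℤ) {w : ℝ} (hw : 0 ≤ w) (γb : ℝ) (c : ℤ) (e : Fin S.n → ℤ) {c' : ℤ} (hc' : c' ≠ 0) {δ₀ : ℝ}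
    {N N₁ T T' t : ℕ} (ht : 1 ≤ t) (hT : T' + t ≤ T) (hN₁ : 2 * N₁ ≤ 6 * N + 5) {A : Fin S.n → ℝ} (hA : ∀ k, |S.lg k| ≤ A k)
    {E : ℝ} (hE : 1 ≤ E) (hsmall : (L S.j₀ : ℝ) * δ₀ * (3 * N + 2) ≤ 1) {C : ℝ} (hC : 1 ≤ C)
    (hineq : ∀ s : ℤ, Odd s → |s| ≤ 2 * (N₁ : ℤ) - 1 → ∀ (a : ℕ) (μ : Fin S.n → ℕ), a + ∑ k, μ k < T' →
      Real.exp (γb * (3 * N + 2)) *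
          (2 * ((2 * N + 1 : ℕ) : ℝ) ^ (t + 1) * t * (20 * Real.exp 1) ^ ((2 * N + 1) * t) *
              ((2 * C) ^ t * Real.exp (γb * (N + 1)) *
                ((2 : ℝ) ^ a * Real.exp ((∑ k, A k * S.GammaC L k) / C) *
                  (U.card * (P * DΔC (S.YC c e L) T') * WC H (ex + 1) L₀ T N * Real.exp ((γb + w) * N) *
                    (2 * ((L S.j₀ : ℝ) * δ₀ * N))))) +
            U.card * (P * DΔC (S.YC c e L) T') * WC H (ex + 1) L₀ T' ((3 * E + 1) * (2 * N + 1) + N) *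
              Real.exp ((w + (L S.j₀ : ℝ) * δ₀) * ((3 * E + 1) * (2 * N + 1) + N)) * (1 / E) ^ ((2 * N + 1) * t)) +
        U.card * (P * DΔC (S.YC c e L) T') * WC H (ex + 1) L₀ T' N₁ * Real.exp ((γb + w) * (3 * N + 2)) *
          (2 * ((L S.j₀ : ℝ) * δ₀ * (3 * N + 2))) <
      (1 + U.card * (P * DΔC (S.YC c e L) T') * S.MtC A L H ex L₀ T' N₁) /
        (4 * (S.DhC L H a s : ℝ) * (1 + U.card * (P * DΔC (S.YC c e L) T') * S.MtC A L H ex L₀ T' N₁) * heightProd S.α ^ 2) ^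
          (2 ^ S.n)) :
    S.ArchHalfStepHypU (fun i : ℕ × K => scaledFeldR i.1 H (ex + 1)) (fun i : ℕ × K => scaledFeldR i.1 H ex) U L P w γb c e c' δ₀
      N N₁ T T' := by
  have hE0 : (0 : ℝ) ≤ E := le_trans zero_le_one hE
  have hρd : (0 : ℝ) ≤ (3 * E + 1) * (2 * N + 1) + N := by positivity
  refine ⟨t, fun a => (2 : ℚ) ^ a, A, S.GammaC L, DΔC (S.YC c e L) T', E, WC H (ex + 1) L₀ T' ((3 * E + 1) * (2 * N + 1) + N),
    WC H (ex + 1) L₀ T N, WC H (ex + 1) L₀ T' N₁, C, S.MtC A L H ex L₀ T' N₁, S.DhC L H, ht, hT, hN₁,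
    fun a => pow_ne_zero _ two_ne_zero, ?_, hc', hA, S.GammaC_nonneg L, fun w' hw' k => S.abs_zγ_le_GammaC hw' k,
    DΔC_nonneg (S.YC_nonneg c e L) T', fun w' hw' a μ haμ => S.abs_prod_multichoose_le_DΔC c e hw' haμ, hE, ?_,
    ArchSupply.WC_nonneg H (ex + 1) L₀ T (Nat.cast_nonneg N), ?_, ArchSupply.WC_nonneg H (ex + 1) L₀ T' (Nat.cast_nonneg N₁), ?_,
    hw, hsmall, hC, fun a s => S.one_le_DhC L H a s, ?_, S.MtC_nonneg A L H ex L₀ T' N₁, ?_, hineq⟩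
  · -- the half-point relation `(Hasse_a R)(s/2) = 2ᵃ (Hasse_a R′)(s)`
    intro i _ a s
    exact ArchSupply.hasse_scaledFeldR_half i.1 H ex a (s : ℚ)
  · -- `Wd` on the disc
    intro i hi a ha z hz
    exact ArchSupply.norm_hw_le_WC hH (ex + 1) i (hU i hi) ha.le hz
  · -- `Wn` at the integers `|x| ≤ N`
    intro i hi t₀ ht₀ x hx
    have hx' : |(x : ℝ)| ≤ N := by exact_mod_cast hx
    exact ArchSupply.abs_hasse_le_WC hH (ex + 1) i (hU i hi) ht₀.le hx'
  · -- `Wh` at the half points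
    intro i hi a ha s _ hs
    exact ArchSupply.norm_hw_le_WC hH (ex + 1) i (hU i hi) ha.le (norm_half_le_of_abs_le hs)
  · -- termwise integrality
    intro a _ s _ _ i _ w' hw'
    exact S.exists_int_DhC_mul L hH i.1 ex a s hw'
  · -- termwise size
    intro a ha s _ hs i hi w' hw'
    exact S.abs_hasse_mul_qEhZ_le_MtC hA L hH ex i (hU i hi) ha hs hw'

end ArchG3Setup

end Summit.ABC.StewartYu

end
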